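import Summits.BirchSwinnertonDyer.BirchSwinnertonDyer.Theorems.PrintCf2SplitBadTwoQuadraticPartTriple
import Summits.BirchSwinnertonDyer.BirchSwinnertonDyer.Theorems.PrintCf2SplitBadTwoAvatarPadicUnits
import Summits.BirchSwinnertonDyer.BirchSwinnertonDyer.Theorems.PrintCf2SplitBadTwoFramePinningDeuring
import Literature.NumberTheory.QuadraticForms.PadicSquares
import HarnessLib

/-!
# O2′b: the values of `(ψ∘c)⁻¹` are `ℚ₂`-rational for every road-α frame (granted Deuring's theorem
# with generators), hence its avatar is `ℤ₂ˣ`-valued and the v10 triple exists — road α, width brick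
# B11d-iii (the last input of `exists_v10_triple` except the algebraicity of `λ`)

Cell `bsd-print-cf2`, seat `bsd-line-cf2-p1-w4` g7, crux `stmt-BirchSwinnertonDyer-20368`
`PrintCf2.SplitBadTwoRankOneOfFacts`.  Theses-free; `--supports` the crux.  Inputs: the v10 triple
constructor `QuadraticPart.exists_v10_triple` (B11d-ii) wants a `ℤ₂ˣ`-valued avatar of
`λ := (ψ∘c)⁻¹`; `AvatarRigidity.exists_padicIntUnitsChar_of_isPAdicAvatarOf` (O2′a) reduces that to
«`ι⁻¹(λ(ϖ_w)) ∈ ℚ₂` for almost all `w`».  THIS FILE proves the latter for every frame of the class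
(member `W` with `C • W = cm7^{(d)}`, `K` imaginary quadratic with `2 = v v̄` split, `c ≠ 1`, `ψ` of type
`(1,0)` pinned by `L(ψ, s) = L(W, s)`), GRANTED the print
`Deuring_exists_heckeCharacter_of_maximalCM_withGenerators` (Silverman ATAEC II Thm. 9.2 / 10.5 with
clause (vi): the values `ψ_W(ϖ_w)` are `σ(α_w)` for generators `α_w` of the primes — a tree NAMED FACT
that implies the S0′ conjunct `Deuring_exists_heckeCharacter_of_maximalCM`):

* §1 `ringHom_apply_mem_range_algebraMap_two` — every ring map `K → ℚ̄₂` of a quadratic field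
  containing `√−7` lands in `ℚ₂` (`−7` is a `2`-adic square, `QuadraticForms.padicInt_isSquare_of_toZModPow_three_eq_one`;
  `K = ℚ ⊕ ℚ√−7`).  The tree's `LambdaSupply.ringHom_apply_mem_range_algebraMap_padic` is the odd-`p` form.
* §2 `eventually_symm_valueAtUniformizer_galConj_inv_mem_range` — if the values `ψ(ϖ_w)` at unramified
  `w` are `σ₀(α_w)`, `α_w ∈ 𝓞_K`, then `ι⁻¹((ψ∘c)⁻¹(ϖ_w)) ∈ ℚ₂` for almost all `w`
  (`valueAtUniformizer_galConj_of_isUnramifiedAt`, `valueAtUniformizer_inv'`, ramification is finite).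
* §3 **`eventually_mem_range_of_frame`** (the frame's `ψ` IS Deuring's `ψ_W`, `FramePinning.eq_of_pinned`,
  so clause (vi) applies) and **`exists_v10_triple_of_frame`**: granted the print and the ALGEBRAICITY of
  `λ = (ψ∘c)⁻¹` (displayed hypothesis; `galConj` by `c : K ≃ₐ[ℚ] K` is not yet bridged to the tree's
  `HasInfinityType.galConj_complexConj` over `K⁺`), every frame and every generator pair of the
  `ℤ₂²`-tower admit `(θK, ρ := θK·λ, r)` with `θK * θK = 1`, `IsPAdicAvatarOf ι ρ r`,
  `FactorsThroughPair κ₁ κ₂ r`, `θK⁻¹ * ρ = λ`, plus S3a's `(θ, n = 2, IsHeckeCharOf ι θ θK)`.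

HONEST FRAMING: conditional on a cited print (clause (vi) of Deuring's theorem) and on `λ.IsAlgebraic`;
closes nothing; beyond-print theorem: no.  BSD is not proved by any of this.

References: [SilvermanATAEC1994] Ch. II Thm. 9.2, Thm. 10.5; [SerreAbelianLadic1968] Ch. II §2.7;
[deShalit1987] II.4.17 (54).
-/

-- the summit namespace `Summit.BirchSwinnertonDyer.BirchSwinnertonDyer` repeats the problem name by design (D-0017)
set_option linter.dupNamespace false
set_option autoImplicit false

noncomputable section

open scoped Classical

open Polynomial NumberField IsDedekindDomain Field Filter WeierstrassCurve
  Literature.NumberTheory.EllipticCurves Literature.NumberTheory.GaloisRepresentations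
  Literature.NumberTheory.EllipticCurves.Rank1Residual
  Literature.NumberTheory.EllipticCurves.KellerYin2024

namespace Summit.BirchSwinnertonDyer.BirchSwinnertonDyer.Theorems.PrintCf2.QuadraticPart

variable {K : Type} [Field K] [NumberField K]

/-! ## §1 A quadratic field containing `√−7` embeds into `ℚ₂` under every map to `ℚ̄₂` -/

/-- **Every ring map `K → ℚ̄₂` of a quadratic field `K ∋ √−7` lands in `ℚ₂`**: `−7` is a `2`-adic square
(`−7 ≡ 1 (mod 8)`), so the image of `√−7` is `± √−7 ∈ ℚ₂`, and `K = ℚ ⊕ ℚ√−7`.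
[cite: Serre1973, Ch. II §3.3 Thm. 4] -/
theorem ringHom_apply_mem_range_algebraMap_two (hK2 : Module.finrank ℚ K = 2) {θ : K}
    (hθ : θ ^ 2 = -7) (φ : K →+* PadicAlgCl 2) (x : K) :
    φ x ∈ Set.range (algebraMap ℚ_[2] (PadicAlgCl 2)) := by
  -- `√-7 ∈ ℤ₂`
  obtain ⟨s, hs⟩ : IsSquare (-7 : ℤ_[2]) :=
    Literature.NumberTheory.QuadraticForms.padicInt_isSquare_of_toZModPow_three_eq_one (p := 2)
      (by rw [map_neg, map_ofNat]; decide)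
  set S : PadicAlgCl 2 := algebraMap ℚ_[2] (PadicAlgCl 2) (s : ℚ_[2]) with hSdef
  have h7 : (s : ℚ_[2]) * (s : ℚ_[2]) = -7 := by
    have h := congrArg ((↑) : ℤ_[2] → ℚ_[2]) hs
    push_cast at h
    exact h.symm
  have hS : S * S = -7 := by rw [hSdef, ← map_mul, h7, map_neg, map_ofNat]
  -- `φ θ = ± S`
  have hφθ : φ θ * φ θ = S * S := by rw [← map_mul, ← sq, hθ, hS, map_neg, map_ofNat]
  have hθS : φ θ ∈ Set.range (algebraMap ℚ_[2] (PadicAlgCl 2)) := by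
    rcases mul_self_eq_mul_self_iff.mp hφθ with h | h
    · exact ⟨(s : ℚ_[2]), h.symm⟩
    · exact ⟨-(s : ℚ_[2]), by rw [map_neg, h]⟩
  -- `K = ℚ ⊕ ℚ θ`
  have hθirr : ∀ a : ℚ, a • (1 : K) ≠ θ := fun a ha ↦ by
    have h1 : (algebraMap ℚ K a) ^ 2 = algebraMap ℚ K (-7) := by
      rw [Algebra.algebraMap_eq_smul_one, ha, hθ, map_neg, map_ofNat]
    rw [← map_pow] at h1
    have h2 : a ^ 2 = -7 := (algebraMap ℚ K).injective h1
    nlinarith [sq_nonneg a]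
  have hli : LinearIndependent ℚ ![(1 : K), θ] := (LinearIndependent.pair_iff' one_ne_zero).mpr hθirr
  have hspan : Submodule.span ℚ (Set.range ![(1 : K), θ]) = ⊤ :=
    hli.span_eq_top_of_card_eq_finrank (by rw [Fintype.card_fin, hK2])
  have hx : x ∈ Submodule.span ℚ (Set.range ![(1 : K), θ]) := by rw [hspan]; exact Submodule.mem_top
  obtain ⟨cf, hcf⟩ := (Submodule.mem_span_range_iff_exists_fun ℚ).mp hx
  simp only [Fin.sum_univ_two, Matrix.cons_val_zero, Matrix.cons_val_one] at hcf
  obtain ⟨t, ht⟩ := hθS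
  refine ⟨(cf 0 : ℚ_[2]) + (cf 1 : ℚ_[2]) * t, ?_⟩
  have hφx : φ x = (cf 0 : PadicAlgCl 2) + (cf 1 : PadicAlgCl 2) * φ θ := by
    rw [← hcf, map_add φ, map_rat_smul φ, map_rat_smul φ, map_one, Rat.smul_one_eq_cast, Rat.smul_def]
  rw [hφx, map_add, map_mul, map_ratCast, map_ratCast, ht]

/-! ## §2 `ℚ₂`-rationality of the values of `(ψ∘c)⁻¹` from generator values of `ψ` -/

/-- **If `ψ(ϖ_w) = σ₀(α_w)` with `α_w ∈ 𝓞_K` at every unramified `w`, then `ι⁻¹((ψ∘c)⁻¹(ϖ_w)) ∈ ℚ₂`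
for almost all `w`** (`K` quadratic with `√−7 ∈ K`; `(ψ∘c)⁻¹(ϖ_w) = ψ(ϖ_{c w})⁻¹` at the cofinitely
many `w` with `ψ` unramified at `c w`). [cite: SilvermanATAEC1994, Ch. II Thm. 9.2]
[cite: SerreAbelianLadic1968, Ch. II §2.7] -/
theorem eventually_symm_valueAtUniformizer_galConj_inv_mem_range (hK2 : Module.finrank ℚ K = 2)
    {θ : K} (hθ : θ ^ 2 = -7) (ι : PadicAlgCl 2 ≃+* ℂ) (c : K ≃ₐ[ℚ] K) {ψ : HeckeCharacter K}
    {σ₀ : K →+* ℂ} (hval : ∀ w : HeightOneSpectrum (𝓞 K), ψ.IsUnramifiedAt w →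
      ∃ α : 𝓞 K, ψ.valueAtUniformizer w = σ₀ α) :
    ∀ᶠ w : HeightOneSpectrum (𝓞 K) in cofinite,
      ι.symm ((HeckeCharacter.galConj c ψ)⁻¹.valueAtUniformizer w) ∈
        Set.range (algebraMap ℚ_[2] (PadicAlgCl 2)) := by
  have hinj : Function.Injective fun w : HeightOneSpectrum (𝓞 K) ↦ c • w := MulAction.injective c
  have hcof : ∀ᶠ w : HeightOneSpectrum (𝓞 K) in cofinite, ψ.IsUnramifiedAt (c • w) :=
    hinj.tendsto_cofinite.eventually (HeckeCharacter.isUnramifiedAt_cofinite_holds ψ)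
  refine hcof.mono fun w hw ↦ ?_
  obtain ⟨α, hα⟩ := hval (c • w) hw
  rw [HeckeCharacter.valueAtUniformizer_inv', HeckeCharacter.valueAtUniformizer_galConj_of_isUnramifiedAt c ψ w hw,
    hα, map_inv₀]
  obtain ⟨t, ht⟩ := ringHom_apply_mem_range_algebraMap_two hK2 hθ
    ((ι.symm : ℂ ≃+* PadicAlgCl 2).toRingHom.comp σ₀) (α : K)
  refine ⟨t⁻¹, ?_⟩
  rw [map_inv₀, ht]
  rfl

/-! ## §3 The frames of road α -/

section Frame

variable {d : ℤ} {W : WeierstrassCurve ℚ} [W.IsElliptic] [W.IsGloballyMinimal] {C : VariableChange ℚ}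
  {v vbar : HeightOneSpectrum (𝓞 K)} {ψ : HeckeCharacter K}

/-- **O2′b for the frames of road α.**  Granted Deuring's theorem WITH GENERATORS (clause (vi)), for
every member `W` (`C • W = cm7^{(d)}`, `d ≠ 0`), every imaginary quadratic `K` with `2 = v v̄` split,
every `c ≠ 1` and every `ψ` of type `(1,0)` pinned to `W` (`L(ψ,s) = L(W,s)`, so `ψ = ψ_W` by
`FramePinning.eq_of_pinned`), the values `ι⁻¹((ψ∘c)⁻¹(ϖ_w))` lie in `ℚ₂ ⊆ ℚ̄₂` for almost all `w`.
[cite: SilvermanATAEC1994, Ch. II Thm. 9.2 and Thm. 10.5 (b)] -/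
theorem eventually_mem_range_of_frame (hDe : Deuring_exists_heckeCharacter_of_maximalCM_withGenerators)
    (hd0 : d ≠ 0) (hC : C • W = cm7.quadraticTwist (d : ℚ)) (hK : IsImaginaryQuadratic K)
    (hv : ((2 : ℕ) : 𝓞 K) ∈ v.asIdeal) (hvbar : ((2 : ℕ) : 𝓞 K) ∈ vbar.asIdeal) (hne : vbar ≠ v)
    (ι : PadicAlgCl 2 ≃+* ℂ) (c : K ≃ₐ[ℚ] K) (hc : c ≠ 1)
    (hψ : ψ.HasInfinityType (fun _ ↦ 1) (fun _ ↦ 0))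
    (hpin : ∀ s : ℂ, 3 / 2 < s.re → heckeLFunction ψ s = W.LSeries s) :
    ∀ᶠ w : HeightOneSpectrum (𝓞 K) in cofinite,
      ι.symm ((HeckeCharacter.galConj c ψ)⁻¹.valueAtUniformizer w) ∈
        Set.range (algebraMap ℚ_[2] (PadicAlgCl 2)) := by
  obtain ⟨⟨θ, hθ⟩, hCM⟩ := FramePinning.exists_sq_eq_neg_seven_of_frame hd0 W hC hK hv hvbar hne hpin
  have hj : W.j ∈ maximalCMJInvariants := (FramePinning.cm_data_of_smul_eq_cm7Twist W hd0 hC).2.1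
  obtain ⟨ψD, hψD, -, -, -, hψDpin, σ₀, hσ₀⟩ := hDe W hj K hCM c hc
  have heq : ψ = ψD := FramePinning.eq_of_pinned hK hψ hψD W (3 / 2) hpin hψDpin
  subst heq
  exact eventually_symm_valueAtUniformizer_galConj_inv_mem_range hK.1 hθ ι c
    fun w hw ↦ let ⟨α, _, hα⟩ := hσ₀ w hw; ⟨α, hα⟩

/-- **The v10 triple for every frame of road α**, granted Deuring's theorem with generators and the
algebraicity of `λ := (ψ∘c)⁻¹`: for every generator pair of the `ℤ₂²`-tower there are the sign data
(`θ̂`; S3a's framed `θ` with `θ² = 1`; `θK` of finite order with `KellerYin2024.IsHeckeCharOf ι θ θK`,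
exact ramification and `θK * θK = 1`), `ρ := θK * λ` (so `θK⁻¹ * ρ = λ`) and a framed `r` with
`IsPAdicAvatarOf ι ρ r` and `FactorsThroughPair κ₁ κ₂ r` — the four antecedents of the v10 laws.  Chain:
Weil's avatar of `λ` (`AvatarRigidity.exists_isPAdicAvatarOf`) is `ℤ₂ˣ`-valued
(`eventually_mem_range_of_frame` + `exists_padicIntUnitsChar_of_isPAdicAvatarOf`), then
`exists_v10_triple`. [cite: deShalit1987, II.4.17 (54)] [cite: SilvermanATAEC1994, Ch. II Thm. 9.2] -/
theorem exists_v10_triple_of_frame (hDe : Deuring_exists_heckeCharacter_of_maximalCM_withGenerators)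
    (hd0 : d ≠ 0) (hC : C • W = cm7.quadraticTwist (d : ℚ)) (hK : IsImaginaryQuadratic K)
    (hv : ((2 : ℕ) : 𝓞 K) ∈ v.asIdeal) (hvbar : ((2 : ℕ) : 𝓞 K) ∈ vbar.asIdeal) (hne : vbar ≠ v)
    (ι : PadicAlgCl 2 ≃+* ℂ) (c : K ≃ₐ[ℚ] K) (hc : c ≠ 1)
    (hψ : ψ.HasInfinityType (fun _ ↦ 1) (fun _ ↦ 0))
    (hpin : ∀ s : ℂ, 3 / 2 < s.re → heckeLFunction ψ s = W.LSeries s)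
    (hlam : (HeckeCharacter.galConj c ψ)⁻¹.IsAlgebraic) (S : Set (PadicAlgCl 2)) :
    ∃ (θs : absoluteGaloisGroup K →ₜ* ℤ_[2]ˣ) (θ : FramedGaloisRep K (padicCoeffIntegers S) 1)
      (θK ρ : HeckeCharacter K) (r : FramedGaloisRep K (PadicAlgCl 2) 1),
      (∀ σ, θs σ = 1 ∨ θs σ = -1) ∧ (∀ σ, θ σ ^ 2 = 1) ∧ (∀ σ, θ σ = 1 ↔ θs σ = 1) ∧
      θK.IsFiniteOrder ∧ IsHeckeCharOf ι θ θK ∧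
      (∀ w : HeightOneSpectrum (𝓞 K), θK.IsUnramifiedAt w ↔ θ.IsUnramifiedAt w) ∧
      θK * θK = 1 ∧ ρ = θK * (HeckeCharacter.galConj c ψ)⁻¹ ∧
      θK⁻¹ * ρ = (HeckeCharacter.galConj c ψ)⁻¹ ∧ IsPAdicAvatarOf ι ρ r ∧
      ∀ {κ₁ κ₂ : ZpExtension K 2} {γ₁ γ₂ : absoluteGaloisGroup K},
        ZpExtension.IsTopGeneratorPair κ₁ κ₂ γ₁ γ₂ → FactorsThroughPair κ₁ κ₂ r := by
  obtain ⟨r₀, hr₀⟩ := AvatarRigidity.exists_isPAdicAvatarOf ι hlam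
  obtain ⟨χ, hχ⟩ := AvatarRigidity.exists_padicIntUnitsChar_of_isPAdicAvatarOf ι hr₀
    (eventually_mem_range_of_frame hDe hd0 hC hK hv hvbar hne ι c hc hψ hpin)
  obtain ⟨θs, θ, θK, ρ, r, hθs, -, hθ2, hθ1, hfin, hH, hram, hsq, hρ, hρ', hav, -, hfac⟩ :=
    exists_v10_triple S ι hK hlam χ (fun σ ↦ by rw [hχ σ]; rfl) hr₀
  exact ⟨θs, θ, θK, ρ, r, hθs, hθ2, hθ1, hfin, hH, hram, hsq, hρ, hρ', hav, hfac⟩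

end Frame

end Summit.BirchSwinnertonDyer.BirchSwinnertonDyer.Theorems.PrintCf2.QuadraticPart

end
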